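import Summits.Ventures.QEC.CircuitDistance.ETowerKX
import HarnessLib

/-!
# E-fold tower ([[144,12,12]], W = 9, node K) — sector X, WINDOW cubes (2, 0) … (2, 7)

STEP 2 of R152 (2) (CARD-7; STEP2-ASSEMBLY-SPEC §B7). Each theorem certifies one scan WINDOW (`W3WIN3`) of the level-C fibre over one of the
4 low-weight `(6,6)` words `W3L` by `decide +kernel` (`nodeCW`; idea-1: ≈ 27 s each). No `native_decide`. Emitted by qec-cdx-eng-1 g2; statements spelled with the sector-qualified names `SecX.nodeCW / SecX.W3L /
SecX.W3WIN3` (same constants) so that their text differs from the sector-Z twins `winZ_k_j` (gate dedup is textual; eng-1 g3).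
-/

set_option maxRecDepth 100000

namespace Summit.Ventures.QEC.CircuitDistance.ETower.SecX

set_option maxHeartbeats 400000000 in
/-- WINDOW FACT (§B7): the level-C fibre of `W3L[2]`, scan window `W3WIN3[0]`, passes. -/
theorem winX_2_0 : SecX.nodeCW (SecX.W3L.getD 2 []) (SecX.W3WIN3.getD 0 (0,0)) = true := by decide +kernel

set_option maxHeartbeats 400000000 in
/-- WINDOW FACT (§B7): the level-C fibre of `W3L[2]`, scan window `W3WIN3[1]`, passes. -/
theorem winX_2_1 : SecX.nodeCW (SecX.W3L.getD 2 []) (SecX.W3WIN3.getD 1 (0,0)) = true := by decide +kernel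

set_option maxHeartbeats 400000000 in
/-- WINDOW FACT (§B7): the level-C fibre of `W3L[2]`, scan window `W3WIN3[2]`, passes. -/
theorem winX_2_2 : SecX.nodeCW (SecX.W3L.getD 2 []) (SecX.W3WIN3.getD 2 (0,0)) = true := by decide +kernel

set_option maxHeartbeats 400000000 in
/-- WINDOW FACT (§B7): the level-C fibre of `W3L[2]`, scan window `W3WIN3[3]`, passes. -/
theorem winX_2_3 : SecX.nodeCW (SecX.W3L.getD 2 []) (SecX.W3WIN3.getD 3 (0,0)) = true := by decide +kernel

set_option maxHeartbeats 400000000 in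
/-- WINDOW FACT (§B7): the level-C fibre of `W3L[2]`, scan window `W3WIN3[4]`, passes. -/
theorem winX_2_4 : SecX.nodeCW (SecX.W3L.getD 2 []) (SecX.W3WIN3.getD 4 (0,0)) = true := by decide +kernel

set_option maxHeartbeats 400000000 in
/-- WINDOW FACT (§B7): the level-C fibre of `W3L[2]`, scan window `W3WIN3[5]`, passes. -/
theorem winX_2_5 : SecX.nodeCW (SecX.W3L.getD 2 []) (SecX.W3WIN3.getD 5 (0,0)) = true := by decide +kernel

set_option maxHeartbeats 400000000 in
/-- WINDOW FACT (§B7): the level-C fibre of `W3L[2]`, scan window `W3WIN3[6]`, passes. -/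
theorem winX_2_6 : SecX.nodeCW (SecX.W3L.getD 2 []) (SecX.W3WIN3.getD 6 (0,0)) = true := by decide +kernel

set_option maxHeartbeats 400000000 in
/-- WINDOW FACT (§B7): the level-C fibre of `W3L[2]`, scan window `W3WIN3[7]`, passes. -/
theorem winX_2_7 : SecX.nodeCW (SecX.W3L.getD 2 []) (SecX.W3WIN3.getD 7 (0,0)) = true := by decide +kernel

end Summit.Ventures.QEC.CircuitDistance.ETower.SecX
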